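import Literature.Analysis.FluidPDE.DEIJCascadeGrowth
import Literature.Analysis.FluidPDE.DEIJCascadeRegularity
import HarnessLib

/-!
# The DEIJ cascade dissipates anomalously: the balanced-growth criterion applied to the cascade

Proof-support file for the discharge of `deij_anomalous_dissipation_eventually`
(`TurbPassiveScalar`); everything is proved, no definitions. It feeds the cascade of
`DEIJCascade` (velocity `u`, inviscid scalar `g`, smooth representatives `gN n`) with the growth
bounds of `DEIJCascadeGrowth` (balanced growth `‖Δg‖² ≤ (C₁‖∇g‖²)²`, `∫₀ᵗ‖∇g‖² → ∞`,
conservation of `∫g²`) and the `L^∞` bound of `DEIJCascadeRegularity` into the criterion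
`DEIJ.le_eScalarDissipation_of_balanced_growth` (`DEIJCriterion`): every weak solution of the
advection–diffusion equation driven by the cascade velocity with an `L²` datum close to the
cascade datum dissipates at least `1/(32C₁²)`, for every `κ > 0`
(`DEIJ.CascadeData.le_eScalarDissipation`). [cite: DrivasEtAl2022, Theorem 2 via Prop. 1.3]

## References

* [DrivasEtAl2022] T. D. Drivas, T. M. Elgindi, G. Iyer, I.-J. Jeong, *Anomalous dissipation in
  passive scalar transport*, Arch. Ration. Mech. Anal. 243 (2022), arXiv:1911.03271, §3.3–3.4.
-/

noncomputable section

open MeasureTheory TopologicalSpace Set Function Filter Topology UnitAddTorus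
open scoped ENNReal NNReal InnerProductSpace ContDiff
open Literature.Analysis.FunctionSpaces
open Literature.Analysis.FunctionSpaces.Torus
open Literature.Analysis.FunctionSpaces.Torus renaming partialDeriv → tPartialDeriv

namespace Literature.Analysis.FluidPDE

namespace Torus

namespace DEIJ

namespace CascadeData

variable {d : Type*} [Fintype d] [DecidableEq d] (D : CascadeData d)

/-- **Anomalous dissipation of the cascade (smooth datum).** If the constants `ρ, W, U, R, C₁`
dominate the initial ratios of the cascade datum `g₀` as in `DEIJCascadeGrowth`, then every weak
solution of the advection–diffusion equation driven by the cascade velocity, with any diffusivity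
`κ > 0` and any `L²` datum `θ₀` within `(8C₁²)^{-1/2}` of `g₀` in `L²`, dissipates at least
`1/(32 C₁²)`: the balanced-growth criterion `le_eScalarDissipation_of_balanced_growth` applied to
the inviscid cascade scalar `g`. [cite: DrivasEtAl2022, Theorem 2, proof §3.3–3.4 with Prop. 1.3] -/
theorem le_eScalarDissipation {ρ Wc U R C₁ : ℝ} (hρ8 : 8 ≤ ρ) (hρ0 : D.Pg 0 ≤ ρ * D.a 0) (hW0 : 0 ≤ Wc)
    (hW : D.ν 0 * ρ ≤ Wc ^ 2) (hU1 : 1 ≤ U) (hUS : 2 * D.S 0 ≤ U * D.a 0) (hUW : 2 * ShearCascade.Cψ1 * Wc ≤ U)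
    (hR : 8 * U + 12 * ShearCascade.Cψ1 * Wc ≤ R) (hC₁ : (Fintype.card d : ℝ) * R ≤ C₁) (hC₁0 : 0 < C₁)
    {θ₀ : UnitAddTorus d → ℝ} (hθ₀ : MemLp θ₀ 2 volume) (hδ : ∫ x, (θ₀ x - D.g₀ x) ^ 2 ≤ 1 / (8 * C₁ ^ 2))
    {κ : ℝ} (hκ : 0 < κ) {θ : ℝ → UnitAddTorus d → ℝ} (hθ : IsWeakScalarTransportOn D.T κ D.u θ₀ θ) :
    ENNReal.ofReal (1 / (32 * C₁ ^ 2)) ≤ eScalarDissipation κ θ 0 D.T := by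
  refine le_eScalarDissipation_of_balanced_growth (g := D.g) hC₁0 D.memLp_top_stLift_u ?_ ?_ D.exists_integral_ge
    (fun t _ => D.integral_sq_laplacian_g_le hρ8 hρ0 hW0 hW hU1 hUS hUW hR hC₁ t) hθ₀ (by rw [D.g_zero]; exact hδ) hκ hθ
  · intro T₁ hT₁
    obtain ⟨n, hn⟩ := D.exists_lt_Tst hT₁
    exact ⟨D.gN n, D.isSmoothSpaceTimeOn_gN n, fun t ht => D.gN_eq_g_of_lt (lt_of_le_of_lt ht hn),
      fun t ht x => D.transport_gN n (lt_of_le_of_lt ht.2 hn) x⟩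
  · intro t _
    rw [D.integral_sq_g t, D.g_zero]

end CascadeData

end DEIJ

end Torus

end Literature.Analysis.FluidPDE
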